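import Mathlib
import Summits.MatrixMultiplication.MatrixMultiplication.Theses.FourierTwoFamiliesModP
import Summits.MatrixMultiplication.MatrixMultiplication.Theorems.FourierTwoFamiliesModPPrimeCyclicPowerGainThetaHalfDensity

/-!
# Route `FourierTwoFamiliesModP`, item stmt-MatrixMultiplication-14316 `HalfDensity`

**Half-density theorem, balanced form, every finite abelian group.**  If `(A i, B i)_{i < n}` are pairs of
`s`-subsets (`s ≥ 1`) of a finite abelian group `H` satisfying the two SDPP clauses

* (W) `a - a' + (b - b') = 0 → a = a' ∧ b = b'` inside each pair `(A i, B i)`,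
* (X) `a ∈ A i, a' ∈ A j, b ∈ B j, b' ∈ B k`, `a - a' + (b - b') = 0 → i = k`,

then `2 · n · s² ≤ |H| · (s + 1)`.

Proof.  This is the integral (rank-one) case of the `ϑ`-HalfDensity inequality already in the tree
(`PrimeCyclicPowerGainTheta.HalfDensity.two_mul_sq_mul_value_le`, file `…ThetaHalfDensity`): for every
symmetric positive-semidefinite trace-one kernel `K` on block pairs `Finset H × Finset H` supported on
admissible, pairwise compatible vertices one has `2 s² · Σ K ≤ |H| (s + 1)`.  Take the rank-one kernel
`K v w = c v · c w / n` with `c` the indicator of the `n` vertices `(A i, B i)` (they are distinct by (X) and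
`s ≥ 1`) and `X₀ = ⋃ᵢ (A i − B i)`: it is symmetric, PSD (`xᵀ K x = (c·x)²/n`), of trace `1`, its support
consists of admissible vertices ((W) and `A i − B i ⊆ X₀`), two distinct ones being compatible because (X)
says exactly that `A i − B j` misses every `A k − B k` when `i ≠ j`; and `Σ K = n² / n = n`.  The resulting
real inequality `2 s² n ≤ |H| (s + 1)` is the claim after casting.  (The character-free `L²` argument of the
item's informal proof is what `two_mul_sq_mul_value_le` carries out in general.)
-/

set_option linter.dupNamespace false

namespace Summit.MatrixMultiplication.MatrixMultiplication.Theorems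

open scoped BigOperators Pointwise

namespace FourierTwoFamiliesModPHalfDensity

/-- Bilinear form of a rank-one kernel: `Σ_v Σ_w x v · (c v c w / t) · y w = (Σ x c)(Σ y c)/t`. -/
theorem sum_sum_rankOne {V : Type*} [Fintype V] (c x y : V → ℝ) (t : ℝ) :
    ∑ v, ∑ w, x v * (c v * c w / t) * y w = (∑ v, x v * c v) * (∑ w, y w * c w) / t := by
  rw [Finset.sum_mul_sum, Finset.sum_div]
  refine Finset.sum_congr rfl fun v _ => ?_
  rw [Finset.sum_div]
  refine Finset.sum_congr rfl fun w _ => ?_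
  ring

/-- Total mass of a rank-one kernel: `Σ_v Σ_w c v c w / t = (Σ c)² / t`. -/
theorem sum_sum_rankOne_one {V : Type*} [Fintype V] (c : V → ℝ) (t : ℝ) :
    ∑ v, ∑ w, c v * c w / t = (∑ v, c v) * (∑ w, c w) / t := by
  have h := sum_sum_rankOne c (fun _ => 1) (fun _ => 1) t
  simpa using h

variable {H : Type*} [AddCommGroup H] [Fintype H] [DecidableEq H]

/-- **HalfDensity, real form.**  For balanced SDPP families `(A i, B i)_{i<n}` of `s`-sets, `s ≥ 1`, in a
finite abelian group `H`: `2 · s² · n ≤ |H| · (s + 1)` — the rank-one case of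
`PrimeCyclicPowerGainTheta.HalfDensity.two_mul_sq_mul_value_le`. -/
theorem two_mul_sq_mul_card_le {n s : ℕ} (A B : Fin n → Finset H) (hs : 1 ≤ s)
    (hcard : ∀ i : Fin n, (A i).card = s ∧ (B i).card = s)
    (hW : ∀ i : Fin n, ∀ a ∈ A i, ∀ a' ∈ A i, ∀ b ∈ B i, ∀ b' ∈ B i,
      (a - a') + (b - b') = 0 → a = a' ∧ b = b')
    (hX : ∀ i j k : Fin n, ∀ a ∈ A i, ∀ a' ∈ A j, ∀ b ∈ B j, ∀ b' ∈ B k,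
      (a - a') + (b - b') = 0 → i = k) :
    2 * (s : ℝ) ^ 2 * (n : ℝ) ≤ (Fintype.card H : ℝ) * ((s : ℝ) + 1) := by
  rcases Nat.eq_zero_or_pos n with hn | hn
  · subst hn
    simp only [Nat.cast_zero, mul_zero]
    positivity
  have hn' : (n : ℝ) ≠ 0 := by exact_mod_cast hn.ne'
  -- the sides are nonempty
  have hAne : ∀ i, (A i).Nonempty := fun i => by
    rw [← Finset.card_pos, (hcard i).1]; exact hs
  have hBne : ∀ i, (B i).Nonempty := fun i => by
    rw [← Finset.card_pos, (hcard i).2]; exact hs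
  -- the `n` vertices `(A i, B i)` are distinct, by (X) with `j = i`
  have hPinj : Function.Injective (fun i : Fin n => (A i, B i)) := by
    intro i j hij
    have hBij : B i = B j := congrArg Prod.snd hij
    obtain ⟨a, ha⟩ := hAne i
    obtain ⟨b, hb⟩ := hBne i
    exact hX i i j a ha a ha b hb b (hBij ▸ hb) (by simp)
  -- the vertex set `S` and its indicator `c`
  obtain ⟨S, hS⟩ : ∃ S : Finset (Finset H × Finset H), S = Finset.univ.image fun i : Fin n => (A i, B i) :=
    ⟨_, rfl⟩
  have hScard : S.card = n := by
    rw [hS, Finset.card_image_of_injective _ hPinj, Finset.card_univ, Fintype.card_fin]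
  have hmemS : ∀ v, v ∈ S → ∃ i : Fin n, (A i, B i) = v := fun v hv => by
    rw [hS, Finset.mem_image] at hv
    obtain ⟨i, -, hi⟩ := hv
    exact ⟨i, hi⟩
  obtain ⟨c, hc⟩ : ∃ c : Finset H × Finset H → ℝ, c = fun v => if v ∈ S then 1 else 0 := ⟨_, rfl⟩
  have hc01 : ∀ v, c v * c v = c v := fun v => by
    simp only [hc]; split_ifs <;> norm_num
  have hcsum : ∑ v, c v = (n : ℝ) := by
    simp only [hc]
    rw [Finset.sum_ite_mem_eq, Finset.sum_const, nsmul_eq_mul, mul_one, hScard]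
  have hcS : ∀ v, c v ≠ 0 → ∃ i : Fin n, (A i, B i) = v := fun v hv => by
    refine hmemS v ?_
    by_contra hvS
    exact hv (by simp only [hc]; rw [if_neg hvS])
  -- the matched-difference set `X₀`
  obtain ⟨X₀, hX₀⟩ : ∃ X₀ : Finset H, X₀ = Finset.univ.biUnion fun i : Fin n => A i - B i := ⟨_, rfl⟩
  have hsub : ∀ i, A i - B i ⊆ X₀ := fun i => by
    rw [hX₀]; exact Finset.subset_biUnion_of_mem (fun k => A k - B k) (Finset.mem_univ i)
  -- compatibility of distinct vertices, by (X)
  have hdisj : ∀ i j : Fin n, i ≠ j → Disjoint (A i - B j) X₀ := by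
    intro i j hij
    rw [Finset.disjoint_left]
    intro x hx hx0
    rw [Finset.mem_sub] at hx
    obtain ⟨a, ha, b, hb, rfl⟩ := hx
    rw [hX₀, Finset.mem_biUnion] at hx0
    obtain ⟨k, -, hk⟩ := hx0
    rw [Finset.mem_sub] at hk
    obtain ⟨a', ha', b', hb', hab⟩ := hk
    have e : (a - a') + (b' - b) = (a - b) - (a' - b') := by abel
    exact hij (hX i k j a ha a' ha' b' hb' b hb (by rw [e, hab, sub_self]))
  -- the rank-one kernel
  obtain ⟨K, hK⟩ : ∃ K : Finset H × Finset H → Finset H × Finset H → ℝ,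
      K = fun v w => c v * c w / n := ⟨_, rfl⟩
  have hsymm : ∀ v w, K v w = K w v := fun v w => by simp only [hK]; ring
  have hpsd : ∀ x : Finset H × Finset H → ℝ, 0 ≤ ∑ v, ∑ w, x v * K v w * x w := fun x => by
    simp only [hK]
    rw [sum_sum_rankOne]
    exact div_nonneg (mul_self_nonneg _) (Nat.cast_nonneg n)
  have htr : ∑ v, K v v = 1 := by
    simp only [hK]
    rw [← Finset.sum_div, Finset.sum_congr rfl fun v _ => hc01 v, hcsum, div_self hn']
  have hval : ∑ v, ∑ w, K v w = n := by
    simp only [hK]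
    rw [sum_sum_rankOne_one, hcsum, mul_div_assoc, div_self hn', mul_one]
  have hsupp : ∀ v w : Finset H × Finset H, K v w ≠ 0 →
      (v.1.card = s ∧ v.2.card = s ∧
        (∀ a ∈ v.1, ∀ a' ∈ v.1, ∀ b ∈ v.2, ∀ b' ∈ v.2, (a - a') + (b - b') = 0 → a = a' ∧ b = b') ∧
        v.1 - v.2 ⊆ X₀) ∧
      (w.1.card = s ∧ w.2.card = s ∧
        (∀ a ∈ w.1, ∀ a' ∈ w.1, ∀ b ∈ w.2, ∀ b' ∈ w.2, (a - a') + (b - b') = 0 → a = a' ∧ b = b') ∧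
        w.1 - w.2 ⊆ X₀) ∧
      (v = w ∨ (Disjoint (v.1 - w.2) X₀ ∧ Disjoint (w.1 - v.2) X₀)) := by
    intro v w hvw
    have hv : c v ≠ 0 := fun h0 => hvw (by simp only [hK]; rw [h0]; simp)
    have hw : c w ≠ 0 := fun h0 => hvw (by simp only [hK]; rw [h0]; simp)
    obtain ⟨i, rfl⟩ := hcS v hv
    obtain ⟨j, rfl⟩ := hcS w hw
    refine ⟨⟨(hcard i).1, (hcard i).2, hW i, hsub i⟩, ⟨(hcard j).1, (hcard j).2, hW j, hsub j⟩, ?_⟩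
    by_cases hij : i = j
    · exact Or.inl (by rw [hij])
    · exact Or.inr ⟨hdisj i j hij, hdisj j i (Ne.symm hij)⟩
  have hmain :=
    PrimeCyclicPowerGainTheta.HalfDensity.two_mul_sq_mul_value_le s hs X₀ K hsymm hpsd hsupp htr
  rwa [hval] at hmain

end FourierTwoFamiliesModPHalfDensity

/-- **Item stmt-MatrixMultiplication-14316** (`HalfDensity`, route `FourierTwoFamiliesModP`): for balanced SDPP
families `(A i, B i)_{i<n}` of `s`-sets (`s ≥ 1`, clauses (W) and (X)) in any finite abelian group `H`,
`2 · n · s² ≤ |H| · (s + 1)`.  Rank-one case of the tree's `ϑ`-HalfDensity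
(`FourierTwoFamiliesModPHalfDensity.two_mul_sq_mul_card_le`), cast from `ℝ` to `ℕ`. -/
theorem halfDensity_proof :
    Summit.MatrixMultiplication.MatrixMultiplication.Theses.FourierTwoFamiliesModP.HalfDensity := by
  unfold Summit.MatrixMultiplication.MatrixMultiplication.Theses.FourierTwoFamiliesModP.HalfDensity
  intro H _ _ n s A B hs hcard hW hX
  classical
  have h := FourierTwoFamiliesModPHalfDensity.two_mul_sq_mul_card_le A B hs hcard hW hX
  have h' : ((2 * n * s ^ 2 : ℕ) : ℝ) ≤ ((Fintype.card H * (s + 1) : ℕ) : ℝ) := by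
    push_cast
    calc (2 : ℝ) * n * (s : ℝ) ^ 2 = 2 * (s : ℝ) ^ 2 * n := by ring
      _ ≤ (Fintype.card H : ℝ) * ((s : ℝ) + 1) := h
  exact_mod_cast h'

end Summit.MatrixMultiplication.MatrixMultiplication.Theorems
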